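import Summits.RiemannHypothesis.RiemannHypothesis.Theorems.Splittings.NbOperator
import HarnessLib

/-!
# Operator axis (NB-NEG V40), part 2: the RH-free COUNT theorem for hyperplane sections of
# Alcántara-Bode's injectivity criterion — cell `rh-split`, raw forms, ZERO defs; typed by
# rh-split-nb-neg g15

Sequel of `NbOperator.lean` (§1 soft side, §2 kernel pairs; same namespace).

* §3 (RH-free COUNT theorem).  If `A` (`alcantaraBodeOp`) is injective on ONE hyperplane
  `{f ∈ L²(0,1) : ∫₀¹ f·w = 0}` (`w ∈ L²(0,1)`), then the zeros of `ζ` in `Re s > 1/2` form AT MOST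
  ONE conjugate pair (`zero_eq_or_eq_conj_of_injOn_hyperplane`): two kernel pairs meeting one
  hyperplane are linearly dependent (`kernelPair_pairing_ne_zero` makes the dependence non-trivial),
  and the three moments `k = 0, 1, 2` of a dependence force `s₂ s̄₂ = s₁ s̄₁`, `s₂ + s̄₂ = s₁ + s̄₁`,
  i.e. `(s₂ - s₁)(s₂ - s̄₁) = 0`.  So the codimension-one TAIL conjunct UNDERSHOOTS RH by exactly
  "one exceptional pair"; the complementary conjunct "no exceptional pair" is
  `QuasiRiemannHypothesis (1/2)`, i.e. RH itself (`quasiRiemannHypothesis_one_half_iff_holds`) —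
  a COUNT partition with an idle finite side (`rh_of_hyperplane_split`).
* §4 (RH side).  Under RH every hyperplane TAIL holds (`injOn_hyperplane_of_rh`,
  `zero_eq_or_eq_conj_of_rh`), so the TAIL is RH-implied and has no lens-(iii) probe.

Every statement spells `_root_.RiemannHypothesis`.  No definitions.
-/

set_option linter.dupNamespace false

open MeasureTheory Set Complex Filter Topology
open scoped ENNReal
open Literature.NumberTheory.LFunctions

namespace Summit.RiemannHypothesis.RiemannHypothesis.Theorems.Splittings.NbOperator

/-! ## §3  The RH-free COUNT theorem: injectivity on one hyperplane ⟹ at most one exceptional pair -/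

/-- The pairing of a kernel pair with the normal vector of an `A`-injective hyperplane is non-zero:
otherwise `m_s` lies in the hyperplane and in `ker A`, so `m_s = 0` a.e., contradicting
`kernelPair_not_ae_zero`. -/
theorem kernelPair_pairing_ne_zero {w : ℝ → ℂ}
    (hw : MemLp w 2 (volume.restrict (Ioo (0 : ℝ) 1)))
    (hinj : ∀ f : ℝ → ℂ, MemLp f 2 (volume.restrict (Ioo (0 : ℝ) 1)) →
      ∫ x in Ioo (0 : ℝ) 1, f x * w x = 0 →
      (∀ᵐ θ ∂(volume.restrict (Ioo (0 : ℝ) 1)), alcantaraBodeOp f θ = 0) →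
        f =ᵐ[volume.restrict (Ioo (0 : ℝ) 1)] 0)
    {s : ℂ} (hζ : riemannZeta s = 0) (hσ : 1 / 2 < s.re) {m : ℝ → ℂ}
    (hm : ∀ x : ℝ, m x = (s - 1) * (x : ℂ) ^ (s - 1) -
      ((starRingEnd ℂ) s - 1) * (x : ℂ) ^ ((starRingEnd ℂ) s - 1)) :
    (∫ x in Ioo (0 : ℝ) 1, m x * w x) ≠ 0 := by
  have _hw := hw
  intro h0
  have hre : 0 < s.re := by linarith
  exact kernelPair_not_ae_zero hζ hre hm
    (hinj m (memLp_kernelPair hσ hm) h0 (alcantaraBodeOp_kernelPair_ae hζ hre hm))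

/-- **COUNT theorem (RH-free).**  If Alcántara-Bode's operator is injective on the hyperplane
`{f ∈ L²(0,1) : ∫₀¹ f·w = 0}` of ONE vector `w ∈ L²(0,1)`, then any two zeros `s₁, s₂` of `ζ` with
`Re sⱼ > 1/2` satisfy `s₂ = s₁` or `s₂ = s̄₁`: the zeros off the critical line form at most one
conjugate pair (with its mirror pair `1 - s`).  Proof: `f = a₂ m_{s₁} - a₁ m_{s₂}`
(`aⱼ = ∫ m_{sⱼ} w ≠ 0`) lies in the hyperplane and in `ker A`, hence vanishes a.e.; its moments
`k = 0, 1, 2` give `A·(s₂+k)(s̄₂+k) = B·(s₁+k)(s̄₁+k)` with `A = a₂(s₁-s̄₁) ≠ 0`, whose second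
difference is `A = B`; then `s₂s̄₂ = s₁s̄₁`, `s₂+s̄₂ = s₁+s̄₁`, so `(s₂-s₁)(s₂-s̄₁) = 0`. -/
theorem zero_eq_or_eq_conj_of_injOn_hyperplane {w : ℝ → ℂ}
    (hw : MemLp w 2 (volume.restrict (Ioo (0 : ℝ) 1)))
    (hinj : ∀ f : ℝ → ℂ, MemLp f 2 (volume.restrict (Ioo (0 : ℝ) 1)) →
      ∫ x in Ioo (0 : ℝ) 1, f x * w x = 0 →
      (∀ᵐ θ ∂(volume.restrict (Ioo (0 : ℝ) 1)), alcantaraBodeOp f θ = 0) →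
        f =ᵐ[volume.restrict (Ioo (0 : ℝ) 1)] 0)
    {s₁ s₂ : ℂ} (hζ₁ : riemannZeta s₁ = 0) (hσ₁ : 1 / 2 < s₁.re)
    (hζ₂ : riemannZeta s₂ = 0) (hσ₂ : 1 / 2 < s₂.re) :
    s₂ = s₁ ∨ s₂ = (starRingEnd ℂ) s₁ := by
  have hre₁ : 0 < s₁.re := by linarith
  have hre₂ : 0 < s₂.re := by linarith
  set u₁ : ℂ := (starRingEnd ℂ) s₁ with hu₁
  set u₂ : ℂ := (starRingEnd ℂ) s₂ with hu₂
  have hσ₁' : 1 / 2 < u₁.re := by simpa [hu₁] using hσ₁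
  have hσ₂' : 1 / 2 < u₂.re := by simpa [hu₂] using hσ₂
  -- the two kernel pairs
  set m₁ : ℝ → ℂ := fun x => (s₁ - 1) * (x : ℂ) ^ (s₁ - 1) - (u₁ - 1) * (x : ℂ) ^ (u₁ - 1)
    with hm₁def
  set m₂ : ℝ → ℂ := fun x => (s₂ - 1) * (x : ℂ) ^ (s₂ - 1) - (u₂ - 1) * (x : ℂ) ^ (u₂ - 1)
    with hm₂def
  have hm₁ : ∀ x : ℝ, m₁ x = (s₁ - 1) * (x : ℂ) ^ (s₁ - 1) -
      ((starRingEnd ℂ) s₁ - 1) * (x : ℂ) ^ ((starRingEnd ℂ) s₁ - 1) := fun x => rfl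
  have hm₂ : ∀ x : ℝ, m₂ x = (s₂ - 1) * (x : ℂ) ^ (s₂ - 1) -
      ((starRingEnd ℂ) s₂ - 1) * (x : ℂ) ^ ((starRingEnd ℂ) s₂ - 1) := fun x => rfl
  have hL₁ : MemLp m₁ 2 (volume.restrict (Ioo (0 : ℝ) 1)) := memLp_kernelPair hσ₁ hm₁
  have hL₂ : MemLp m₂ 2 (volume.restrict (Ioo (0 : ℝ) 1)) := memLp_kernelPair hσ₂ hm₂
  have hi₁ : IntegrableOn m₁ (Ioo (0 : ℝ) 1) := hL₁.integrable one_le_two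
  have hi₂ : IntegrableOn m₂ (Ioo (0 : ℝ) 1) := hL₂.integrable one_le_two
  -- the pairings with `w` are non-zero
  set a₁ : ℂ := ∫ x in Ioo (0 : ℝ) 1, m₁ x * w x with ha₁
  set a₂ : ℂ := ∫ x in Ioo (0 : ℝ) 1, m₂ x * w x with ha₂
  have ha₁0 : a₁ ≠ 0 := kernelPair_pairing_ne_zero hw hinj hζ₁ hσ₁ hm₁
  have ha₂0 : a₂ ≠ 0 := kernelPair_pairing_ne_zero hw hinj hζ₂ hσ₂ hm₂
  -- the combination in the hyperplane
  set f : ℝ → ℂ := fun x => a₂ * m₁ x - a₁ * m₂ x with hfdef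
  have hf : ∀ x : ℝ, f x = a₂ * m₁ x - a₁ * m₂ x := fun x => rfl
  have hfL : MemLp f 2 (volume.restrict (Ioo (0 : ℝ) 1)) := (hL₁.const_mul a₂).sub (hL₂.const_mul a₁)
  have hfw : ∫ x in Ioo (0 : ℝ) 1, f x * w x = 0 := by
    have hsplit : (fun x : ℝ => f x * w x) =
        fun x : ℝ => a₂ * (m₁ x * w x) - a₁ * (m₂ x * w x) := by
      funext x; rw [hf]; ring
    rw [hsplit, integral_sub ((integrable_mul_of_memLp_two_Ioo hL₁ hw).const_mul _)
        ((integrable_mul_of_memLp_two_Ioo hL₂ hw).const_mul _),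
      integral_const_mul, integral_const_mul]
    rw [← ha₁, ← ha₂]
    ring
  have hfA : ∀ᵐ θ ∂(volume.restrict (Ioo (0 : ℝ) 1)), alcantaraBodeOp f θ = 0 := by
    filter_upwards [ae_restrict_mem measurableSet_Ioo] with θ hθ
    rw [alcantaraBodeOp_lincomb hi₁ hi₂ hf θ, alcantaraBodeOp_kernelPair hζ₁ hre₁ hm₁ hθ,
      alcantaraBodeOp_kernelPair hζ₂ hre₂ hm₂ hθ]
    ring
  have hf0 : f =ᵐ[volume.restrict (Ioo (0 : ℝ) 1)] 0 := hinj f hfL hfw hfA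
  -- moments of the dependence
  have hmom : ∀ k : ℕ,
      a₂ * ((s₁ - 1) / (s₁ + k) - (u₁ - 1) / (u₁ + k)) -
        a₁ * ((s₂ - 1) / (s₂ + k) - (u₂ - 1) / (u₂ + k)) = 0 := by
    intro k
    have h0 : ∫ x in Ioo (0 : ℝ) 1, f x * (x : ℂ) ^ k = 0 := by
      rw [integral_congr_ae (g := 0) (by filter_upwards [hf0] with x hx; simp [hx])]
      simp
    have hsplit : (fun x : ℝ => f x * (x : ℂ) ^ k) =
        fun x : ℝ => a₂ * (m₁ x * (x : ℂ) ^ k) - a₁ * (m₂ x * (x : ℂ) ^ k) := by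
      funext x; rw [hf]; ring
    have hI₁ : Integrable (fun x : ℝ => m₁ x * (x : ℂ) ^ k) (volume.restrict (Ioo (0 : ℝ) 1)) :=
      hi₁.mul_bdd ((Complex.measurable_ofReal.pow_const k).aestronglyMeasurable)
        (c := 1) (by
          filter_upwards [ae_restrict_mem measurableSet_Ioo] with x hx
          rw [norm_pow, Complex.norm_real, Real.norm_eq_abs, abs_of_pos hx.1]
          exact pow_le_one₀ hx.1.le hx.2.le)
    have hI₂ : Integrable (fun x : ℝ => m₂ x * (x : ℂ) ^ k) (volume.restrict (Ioo (0 : ℝ) 1)) :=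
      hi₂.mul_bdd ((Complex.measurable_ofReal.pow_const k).aestronglyMeasurable)
        (c := 1) (by
          filter_upwards [ae_restrict_mem measurableSet_Ioo] with x hx
          rw [norm_pow, Complex.norm_real, Real.norm_eq_abs, abs_of_pos hx.1]
          exact pow_le_one₀ hx.1.le hx.2.le)
    rw [hsplit, integral_sub (hI₁.const_mul _) (hI₂.const_mul _), integral_const_mul,
      integral_const_mul, integral_kernelPair_mul_pow hre₁ hm₁ k,
      integral_kernelPair_mul_pow hre₂ hm₂ k] at h0
    exact h0
  -- polynomial form: `a₂(s₁-u₁)·(s₂+k)(u₂+k) = a₁(s₂-u₂)·(s₁+k)(u₁+k)`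
  have E : ∀ k : ℕ, a₂ * (s₁ - u₁) * ((s₂ + k) * (u₂ + k)) =
      a₁ * (s₂ - u₂) * ((s₁ + k) * (u₁ + k)) := by
    intro k
    obtain ⟨hs₁k, hu₁k⟩ := add_natCast_ne_zero_of_re_pos hre₁ k
    obtain ⟨hs₂k, hu₂k⟩ := add_natCast_ne_zero_of_re_pos hre₂ k
    have hk := hmom k
    rw [kernelPair_moment_eq k hs₁k hu₁k, kernelPair_moment_eq k hs₂k hu₂k, sub_eq_zero,
      mul_div_assoc', mul_div_assoc', div_eq_div_iff (mul_ne_zero hs₁k hu₁k)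
        (mul_ne_zero hs₂k hu₂k)] at hk
    have hk1 : (k : ℂ) + 1 ≠ 0 := by
      have : (k : ℂ) + 1 = ((k + 1 : ℕ) : ℂ) := by push_cast; ring
      rw [this]; exact Nat.cast_ne_zero.2 (Nat.succ_ne_zero k)
    exact mul_left_cancel₀ hk1 (by linear_combination hk)
  have E0 := E 0
  have E1 := E 1
  have E2 := E 2
  simp only [Nat.cast_zero, add_zero, Nat.cast_one, Nat.cast_ofNat] at E0 E1 E2
  have hA0 : a₂ * (s₁ - u₁) ≠ 0 :=
    mul_ne_zero ha₂0 (sub_conj_ne_zero_of_zeta_eq_zero hζ₁ hre₁)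
  have hAB : a₂ * (s₁ - u₁) = a₁ * (s₂ - u₂) := by
    linear_combination (E2 - 2 * E1 + E0) / 2
  have e0 : s₂ * u₂ = s₁ * u₁ :=
    mul_left_cancel₀ hA0 (by linear_combination E0 - (s₁ * u₁) * hAB)
  have e1 : s₂ + u₂ = s₁ + u₁ :=
    mul_left_cancel₀ hA0 (by linear_combination E1 - E0 - (s₁ + u₁ + 1) * hAB)
  have hprod : (s₂ - s₁) * (s₂ - u₁) = 0 := by
    linear_combination (-1 : ℂ) * e0 + s₂ * e1
  rcases mul_eq_zero.1 hprod with h | h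
  · exact Or.inl (sub_eq_zero.1 h)
  · exact Or.inr (sub_eq_zero.1 h)

/-! ## §4  The RH side and the count partition -/

/-- Under RH, `A` is injective on every hyperplane (indeed on all of `L²(0,1)`, the tree's
`alcantaraBode_injective_of_riemannHypothesis`): the codimension-one TAIL conjunct is RH-implied. -/
theorem injOn_hyperplane_of_rh (hRH : RiemannHypothesis) (w : ℝ → ℂ) :
    ∀ f : ℝ → ℂ, MemLp f 2 (volume.restrict (Ioo (0 : ℝ) 1)) →
      ∫ x in Ioo (0 : ℝ) 1, f x * w x = 0 →
      (∀ᵐ θ ∂(volume.restrict (Ioo (0 : ℝ) 1)), alcantaraBodeOp f θ = 0) →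
        f =ᵐ[volume.restrict (Ioo (0 : ℝ) 1)] 0 :=
  fun _ hf _ hA => alcantaraBode_injective_of_riemannHypothesis hRH hf hA

/-- RH ⟹ at most one exceptional pair (of course: none), through the hyperplane theorem with
`w = 0` — recorded to make the direction of `zero_eq_or_eq_conj_of_injOn_hyperplane` explicit. -/
theorem zero_eq_or_eq_conj_of_rh (hRH : RiemannHypothesis) {s₁ s₂ : ℂ}
    (hζ₁ : riemannZeta s₁ = 0) (hσ₁ : 1 / 2 < s₁.re) (hζ₂ : riemannZeta s₂ = 0)
    (hσ₂ : 1 / 2 < s₂.re) : s₂ = s₁ ∨ s₂ = (starRingEnd ℂ) s₁ :=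
  zero_eq_or_eq_conj_of_injOn_hyperplane (w := fun _ => 0) (memLp_const 0)
    (injOn_hyperplane_of_rh hRH _) hζ₁ hσ₁ hζ₂ hσ₂

/-- **Count partition (costume detector).**  In the splitting
`TAIL₁ ∧ FIN₁ ⟹ RH` with `TAIL₁` = "A injective on a hyperplane" and `FIN₁` = "no exceptional pair"
= `QuasiRiemannHypothesis (1/2)`, the finite conjunct alone is RH
(`quasiRiemannHypothesis_one_half_iff_holds`); the tail is not used. -/
theorem rh_of_hyperplane_split {w : ℝ → ℂ}
    (_tail : ∀ f : ℝ → ℂ, MemLp f 2 (volume.restrict (Ioo (0 : ℝ) 1)) →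
      ∫ x in Ioo (0 : ℝ) 1, f x * w x = 0 →
      (∀ᵐ θ ∂(volume.restrict (Ioo (0 : ℝ) 1)), alcantaraBodeOp f θ = 0) →
        f =ᵐ[volume.restrict (Ioo (0 : ℝ) 1)] 0)
    (fin : QuasiRiemannHypothesis (1 / 2)) : RiemannHypothesis :=
  quasiRiemannHypothesis_one_half_iff_holds.1 fin

end Summit.RiemannHypothesis.RiemannHypothesis.Theorems.Splittings.NbOperator
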